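/-
Copyright (c) 2026 The decomp-a2c cell. All rights reserved.
Released under Apache 2.0 license as described in the file LICENSE.
-/
import Summits.AtomisticToContinuum.Crystallization.Theorems.ChartedZeroExcessLayeredLatticeLiouvilleWD

/-!
# ChartedZeroExcessLayeredLatticeLiouville — part WE «DivergenceL2»: the square sum of the column-flux divergence over a block of sites
  (decomp-a2c-lens-2, g58; helper of stmt-AtomisticToContinuum-26636, leaf (LD′) `ModalLipschitzZ`; brick (4a) `ModalLipschitzAt`, vertical half (4a⊥),
  step (SG) of memo NODE-g58c)

WD bounded the divergence `DIV(X) = colFlux T ψ γ m − colFlux T ψ γ (m−1)` of the column flux of a field harmonic at `X = (γ, m)` by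
`2F·Σ_{Y near X} idxWt (Y−X)·(‖pgram ψ X Y‖ + ‖sdiff2 ψ X Y‖)`.  This part sums the SQUARES over a finite block `Xs` of sites:
* the parallelogram term is, by WD's lattice-path telescoping and Cauchy–Schwarz, `‖pgram ψ X (X+v)‖² ≤ 2·N(v)²·pathSq ψ X v`, where `pathSq` is the
  sum of the squares of the MIXED second differences `D₃D₁ψ`, `D₃D₂ψ` met along the `N(v)·2N(v)` path bonds; the weighted Cauchy–Schwarz with the second
  moment `Σ idxWt·N² ≤ 54` gives `(Σ_Y idxWt·‖pgram‖)² ≤ 108·Σ_v idxWt(v)·pathSq ψ X v`, and summing over the block each path bond is a TRANSLATE of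
  `X`, so `Σ_X pathSq ψ X v ≤ N(v)²·(P₁ + P₂)` with `P_a = Σ_{X' ∈ R} ‖D₃D_aψ (X')‖²` over any region `R` containing the `⌊ϱ/c⌋`-neighbourhood of the
  block — altogether `Σ_X (Σ_Y idxWt·‖pgram‖)² ≤ 5832·(P₁ + P₂)`;
* the second-difference term is bounded POINTWISE by WD `norm_sdiff2_le` from a sup bound `G₂` of the in-plane second differences on the
  `3⌊ϱ/c⌋`-neighbourhood of the block: `Σ_Y idxWt·‖sdiff2‖ ≤ 216·G₂`;
* ★ `sum_colFluxDiv_sq_le`: `Σ_{X ∈ Xs} ‖DIV(X)‖² ≤ 8F²·(5832·(P₁ + P₂) + #Xs·(216·G₂)²)`.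
In step (SG) both `P₁ + P₂` (energies of the harmonic fields `D₁ψ`, `D₂ψ`, WA `energy_iterate`) and `#Xs·G₂²` (WA `inPlane_hessian_core`) are `O(E/n²)`.
-/

namespace Summit.AtomisticToContinuum.Crystallization.Theorems.ChartedZeroExcessLayeredLatticeLiouville

open Summit.AtomisticToContinuum.Crystallization.Theorems.ChartedPlanarOrderRigidityDoor (E3)
open Finset
open scoped InnerProductSpace RealInnerProductSpace BigOperators

noncomputable section DivergenceL2

variable {c : ℝ} {a b : E3} {w : ℤ → E3}

/-! ### WE.1  Algebraic helpers -/

/-- lattice differences commute. [formal bookkeeping] -/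
theorem latDiff_latDiff_comm (E E' : Cell 2 × ℤ) (φ : Cell 2 → ℤ → E3) : latDiff E (latDiff E' φ) = latDiff E' (latDiff E φ) := by
  funext p α
  simp only [latDiff, latShift, Pi.sub_apply]
  rw [add_right_comm p E.1 E'.1, add_right_comm α E.2 E'.2]
  abel

/-- antisymmetry of the parallelogram difference under exchanging the two layers. [formal bookkeeping] -/
theorem pgram_swap (ψ : Cell 2 → ℤ → E3) (γ δ : Cell 2) (m β : ℤ) : pgram ψ (γ, m) (δ, β) = -pgram ψ (γ, β) (δ, m) := by
  simp only [pgram]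
  abel

/-- CAUCHY–SCHWARZ for a double sum of two families: `(Σ_j (Σ_{i∈s₁} f + Σ_{i∈s₂} g))² ≤ Σ_j #s·2·(#s₁·Σ f² + #s₂·Σ g²)`. [formal bookkeeping] -/
theorem sq_sum_add_sum_le (s s₁ s₂ : Finset ℕ) (f g : ℕ → ℕ → ℝ) :
    (∑ j ∈ s, ((∑ i ∈ s₁, f j i) + ∑ i ∈ s₂, g j i)) ^ 2 ≤
      ∑ j ∈ s, (#s : ℝ) * (2 * ((#s₁ : ℝ) * ∑ i ∈ s₁, f j i ^ 2 + (#s₂ : ℝ) * ∑ i ∈ s₂, g j i ^ 2)) := by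
  refine sq_sum_le_card_mul_sum_sq.trans ((mul_sum _ _ _).trans_le (sum_le_sum fun j _ => ?_))
  refine mul_le_mul_of_nonneg_left ?_ (Nat.cast_nonneg _)
  have e0 : (∑ i ∈ s₁, f j i) ^ 2 ≤ #s₁ * ∑ i ∈ s₁, f j i ^ 2 := sq_sum_le_card_mul_sum_sq
  have e1 : (∑ i ∈ s₂, g j i) ^ 2 ≤ #s₂ * ∑ i ∈ s₂, g j i ^ 2 := sq_sum_le_card_mul_sum_sq
  nlinarith [sq_nonneg ((∑ i ∈ s₁, f j i) - ∑ i ∈ s₂, g j i)]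

/-- the elementary count behind the parallelogram bound: `T·2·(D₀A + D₁B) ≤ 2N²(A + B)` for `T, D₀, D₁ ≤ N`. [formal bookkeeping] -/
theorem card_mul_two_le {T D₀ D₁ N A B : ℝ} (hT : T ≤ N) (h₀ : D₀ ≤ N) (h₁ : D₁ ≤ N) (hT0 : 0 ≤ T) (hD₀ : 0 ≤ D₀) (hD₁ : 0 ≤ D₁)
    (hA : 0 ≤ A) (hB : 0 ≤ B) : T * (2 * (D₀ * A + D₁ * B)) ≤ 2 * N ^ 2 * (A + B) := by
  have e0 : T * D₀ ≤ N * N := mul_le_mul hT h₀ hD₀ (hT0.trans hT)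
  have e1 : T * D₁ ≤ N * N := mul_le_mul hT h₁ hD₁ (hT0.trans hT)
  nlinarith [mul_le_mul_of_nonneg_right e0 hA, mul_le_mul_of_nonneg_right e1 hB]

/-! ### WE.2  The path square-sum and the parallelogram bound in mean square -/

/-- the PATH SQUARE-SUM of `ψ` at `X` for the offset `v = (d, t)`: the sum of the squares of the mixed second differences `D₃D₁ψ`, `D₃D₂ψ` over the
`|t|` gaps between the layers `X.2` and `X.2 + t` and over the bonds of the two-segment lattice path from `X.1` to `X.1 + d` (the terms of WD
`norm_pgram_le`, squared). [this file, g58] -/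
def pathSq (ψ : Cell 2 → ℤ → E3) (X v : Cell 2 × ℤ) : ℝ :=
  ∑ j ∈ range v.2.natAbs,
    ((∑ i ∈ range (v.1 0).natAbs,
        ‖latDiff idxAxis₃ (latDiff idxAxis₁ ψ) (X.1 + (min (v.1 0) 0 + ((i : ℕ) : ℤ)) • (Pi.single 0 1 : Cell 2)) (X.2 + (min v.2 0 + ((j : ℕ) : ℤ)))‖ ^ 2) +
      ∑ i ∈ range (v.1 1).natAbs,
        ‖latDiff idxAxis₃ (latDiff idxAxis₂ ψ) (X.1 + (v.1 0 • (Pi.single 0 1 : Cell 2) + (min (v.1 1) 0 + ((i : ℕ) : ℤ)) • (Pi.single 1 1 : Cell 2)))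
          (X.2 + (min v.2 0 + ((j : ℕ) : ℤ)))‖ ^ 2)

/-- the path square-sum is non-negative. [formal bookkeeping] -/
theorem pathSq_nonneg (ψ : Cell 2 → ℤ → E3) (X v : Cell 2 × ℤ) : 0 ≤ pathSq ψ X v :=
  sum_nonneg fun _ _ => add_nonneg (sum_nonneg fun _ _ => sq_nonneg _) (sum_nonneg fun _ _ => sq_nonneg _)

/-- WD `norm_pgram_le` for an offset of either sign of the layer: `‖pgram ψ (γ, m) (γ + d, m + t)‖` is at most the sum over the `|t|` gaps between the two
layers and over the path bonds of the norms of the mixed second differences. [formal bookkeeping] -/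
theorem norm_pgram_le' (ψ : Cell 2 → ℤ → E3) (γ d : Cell 2) (m t : ℤ) :
    ‖pgram ψ (γ, m) (γ + d, m + t)‖ ≤
      ∑ j ∈ range t.natAbs,
        ((∑ i ∈ range (d 0).natAbs,
            ‖latDiff idxAxis₃ (latDiff idxAxis₁ ψ) (γ + (min (d 0) 0 + ((i : ℕ) : ℤ)) • (Pi.single 0 1 : Cell 2)) (m + (min t 0 + ((j : ℕ) : ℤ)))‖) +
          ∑ i ∈ range (d 1).natAbs,
            ‖latDiff idxAxis₃ (latDiff idxAxis₂ ψ) (γ + (d 0 • (Pi.single 0 1 : Cell 2) + (min (d 1) 0 + ((i : ℕ) : ℤ)) • (Pi.single 1 1 : Cell 2)))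
              (m + (min t 0 + ((j : ℕ) : ℤ)))‖) := by
  rw [← latDiff_latDiff_comm idxAxis₁ idxAxis₃ ψ, ← latDiff_latDiff_comm idxAxis₂ idxAxis₃ ψ]
  rcases le_or_gt t 0 with ht | ht
  · have h1 : m + t + ((t.natAbs : ℕ) : ℤ) = m := by omega
    have key := norm_pgram_le ψ γ d (m + t) t.natAbs
    rw [h1] at key
    refine key.trans (le_of_eq (sum_congr rfl fun j _ => ?_))
    simp only [min_eq_left ht, add_assoc]
  · have h1 : m + t = m + ((t.natAbs : ℕ) : ℤ) := by omega
    rw [pgram_swap, norm_neg, h1]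
    refine (norm_pgram_le ψ γ d m t.natAbs).trans (le_of_eq (sum_congr rfl fun j _ => ?_))
    simp only [min_eq_right ht.le, zero_add, add_assoc]

/-- ★ THE PARALLELOGRAM BOUND IN MEAN SQUARE: `‖pgram ψ (γ, m) (γ + d, m + t)‖² ≤ 2·N(d, t)²·pathSq ψ (γ, m) (d, t)` (WD `norm_pgram_le` has at most
`|t|·(|d 0| + |d 1|) ≤ 2N²` terms; Cauchy–Schwarz). [this file, g58] -/
theorem norm_pgram_sq_le (ψ : Cell 2 → ℤ → E3) (γ d : Cell 2) (m t : ℤ) :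
    ‖pgram ψ (γ, m) (γ + d, m + t)‖ ^ 2 ≤ 2 * (idxNorm (d, t) : ℝ) ^ 2 * pathSq ψ (γ, m) (d, t) := by
  have hN0 : (((d 0).natAbs : ℕ) : ℝ) ≤ idxNorm (d, t) := by exact_mod_cast natAbs_fst_le_idxNorm (d, t) 0
  have hN1 : (((d 1).natAbs : ℕ) : ℝ) ≤ idxNorm (d, t) := by exact_mod_cast natAbs_fst_le_idxNorm (d, t) 1
  have hNt : ((t.natAbs : ℕ) : ℝ) ≤ idxNorm (d, t) := by exact_mod_cast natAbs_snd_le_idxNorm (d, t)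
  refine (pow_le_pow_left₀ (norm_nonneg _) (norm_pgram_le' ψ γ d m t) 2).trans ?_
  refine (sq_sum_add_sum_le _ _ _ _ _).trans ?_
  rw [pathSq, mul_sum]
  refine sum_le_sum fun j _ => ?_
  rw [card_range, card_range, card_range]
  exact card_mul_two_le hNt hN0 hN1 (Nat.cast_nonneg _) (Nat.cast_nonneg _) (Nat.cast_nonneg _) (sum_nonneg fun i _ => sq_nonneg _)
    (sum_nonneg fun i _ => sq_nonneg _)

/-- ★ THE WEIGHTED PARALLELOGRAM SUM at a site: `(Σ_{Y ∈ V} idxWt (Y−X)·‖pgram ψ X Y‖)² ≤ 108·Σ_{Y ∈ V} idxWt (Y−X)·pathSq ψ X (Y−X)` (weighted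
Cauchy–Schwarz against the second moment `Σ idxWt·N² ≤ 54` of WD `sum_idxWt_mul_sq_le`). [this file, g58] -/
theorem sum_wt_pgram_sq_le (ψ : Cell 2 → ℤ → E3) (γ : Cell 2) (m : ℤ) (V : Finset (Cell 2 × ℤ)) :
    (∑ Y ∈ V, idxWt (Y - (γ, m)) * ‖pgram ψ (γ, m) Y‖) ^ 2 ≤ 108 * ∑ Y ∈ V, idxWt (Y - (γ, m)) * pathSq ψ (γ, m) (Y - (γ, m)) := by
  have key : (∑ Y ∈ V, idxWt (Y - (γ, m)) * ‖pgram ψ (γ, m) Y‖) ^ 2 ≤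
      (∑ Y ∈ V, idxWt (Y - (γ, m)) * (idxNorm (Y - (γ, m)) : ℝ) ^ 2) * ∑ Y ∈ V, idxWt (Y - (γ, m)) * (2 * pathSq ψ (γ, m) (Y - (γ, m))) := by
    refine Finset.sum_sq_le_sum_mul_sum_of_sq_le_mul V (fun Y _ => mul_nonneg (idxWt_nonneg _) (sq_nonneg _))
      (fun Y _ => mul_nonneg (idxWt_nonneg _) (mul_nonneg zero_le_two (pathSq_nonneg _ _ _))) fun Y _ => ?_
    obtain ⟨⟨d, t⟩, rfl⟩ : ∃ v : Cell 2 × ℤ, Y = (γ + v.1, m + v.2) := ⟨Y - (γ, m), Prod.ext (by simp) (by simp)⟩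
    dsimp only
    have hv : (γ + d, m + t) - (γ, m) = (d, t) := Prod.ext (add_sub_cancel_left _ _) (add_sub_cancel_left _ _)
    rw [hv, mul_pow]
    have h := norm_pgram_sq_le ψ γ d m t
    have hw := idxWt_nonneg (d, t)
    nlinarith [mul_le_mul_of_nonneg_left h (mul_nonneg hw hw)]
  have h54 := sum_idxWt_mul_sq_le V (γ, m)
  have hS0 : 0 ≤ ∑ Y ∈ V, idxWt (Y - (γ, m)) * pathSq ψ (γ, m) (Y - (γ, m)) :=
    sum_nonneg fun Y _ => mul_nonneg (idxWt_nonneg _) (pathSq_nonneg _ _ _)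
  have h2 : ∑ Y ∈ V, idxWt (Y - (γ, m)) * (2 * pathSq ψ (γ, m) (Y - (γ, m))) = 2 * ∑ Y ∈ V, idxWt (Y - (γ, m)) * pathSq ψ (γ, m) (Y - (γ, m)) := by
    rw [mul_sum]
    exact sum_congr rfl fun Y _ => by ring
  rw [h2] at key
  nlinarith [mul_le_mul_of_nonneg_right h54 (mul_nonneg zero_le_two hS0)]

/-! ### WE.3  The second-difference term -/

/-- WD `norm_sdiff2_le` for a near offset: if `N(d, t) ≤ r` and the in-plane second differences of the layer `m` are bounded by `G₂` on the coordinate box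
of half-width `3r` about `γ`, then `‖sdiff2 ψ (γ, m) (γ + d, m + t)‖ ≤ 4·N(d, t)²·G₂`. [formal bookkeeping] -/
theorem norm_sdiff2_le_of_idxNorm_le (ψ : Cell 2 → ℤ → E3) (γ d : Cell 2) (m t : ℤ) {r : ℕ} (hr : idxNorm (d, t) ≤ r) {G₂ : ℝ} (hG0 : 0 ≤ G₂)
    (hG : ∀ p : Cell 2, (∀ j, |p j - γ j| ≤ 3 * (r : ℤ)) →
      ‖latDiff idxAxis₁ (latDiff idxAxis₁ ψ) p m‖ ≤ G₂ ∧ ‖latDiff idxAxis₂ (latDiff idxAxis₁ ψ) p m‖ ≤ G₂ ∧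
      ‖latDiff idxAxis₁ (latDiff idxAxis₂ ψ) p m‖ ≤ G₂ ∧ ‖latDiff idxAxis₂ (latDiff idxAxis₂ ψ) p m‖ ≤ G₂) :
    ‖sdiff2 ψ (γ, m) (γ + d, m + t)‖ ≤ 4 * (idxNorm (d, t) : ℝ) ^ 2 * G₂ := by
  have hM : ∀ j, |d j| ≤ ((idxNorm (d, t) : ℕ) : ℤ) := fun j => by
    have h := natAbs_fst_le_idxNorm (d, t) j
    dsimp only at h
    rw [Int.abs_eq_natAbs]
    exact_mod_cast h
  have h3 : ((idxNorm (d, t) : ℕ) : ℤ) + idxNorm (d, t) + idxNorm (d, t) ≤ 3 * (r : ℤ) := by omega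
  have key := norm_sdiff2_le ψ γ d m (m + t) hM (G₂ := G₂) fun p hp => hG p fun j => (hp j).trans h3
  refine key.trans (mul_le_mul_of_nonneg_right ?_ hG0)
  have e0 : (((d 0).natAbs : ℕ) : ℝ) ≤ idxNorm (d, t) := by exact_mod_cast natAbs_fst_le_idxNorm (d, t) 0
  have e1 : (((d 1).natAbs : ℕ) : ℝ) ≤ idxNorm (d, t) := by exact_mod_cast natAbs_fst_le_idxNorm (d, t) 1
  have h : ((((d 0).natAbs + (d 1).natAbs : ℕ)) : ℝ) ≤ 2 * idxNorm (d, t) := by push_cast; linarith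
  calc ((((d 0).natAbs + (d 1).natAbs : ℕ)) : ℝ) ^ 2 ≤ (2 * (idxNorm (d, t) : ℝ)) ^ 2 := pow_le_pow_left₀ (Nat.cast_nonneg _) h 2
    _ = 4 * (idxNorm (d, t) : ℝ) ^ 2 := by ring

/-- ★ THE WEIGHTED SECOND-DIFFERENCE SUM at a site: over near sites `Y` (`N(Y − X) ≤ r`), `Σ_Y idxWt (Y−X)·‖sdiff2 ψ X Y‖ ≤ 216·G₂`
(`norm_sdiff2_le_of_idxNorm_le` and the second moment `Σ idxWt·N² ≤ 54`). [this file, g58] -/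
theorem sum_wt_sdiff2_le (ψ : Cell 2 → ℤ → E3) (γ : Cell 2) (m : ℤ) {r : ℕ} (V : Finset (Cell 2 × ℤ)) (hV : ∀ Y ∈ V, idxNorm (Y - (γ, m)) ≤ r)
    {G₂ : ℝ} (hG0 : 0 ≤ G₂)
    (hG : ∀ p : Cell 2, (∀ j, |p j - γ j| ≤ 3 * (r : ℤ)) →
      ‖latDiff idxAxis₁ (latDiff idxAxis₁ ψ) p m‖ ≤ G₂ ∧ ‖latDiff idxAxis₂ (latDiff idxAxis₁ ψ) p m‖ ≤ G₂ ∧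
      ‖latDiff idxAxis₁ (latDiff idxAxis₂ ψ) p m‖ ≤ G₂ ∧ ‖latDiff idxAxis₂ (latDiff idxAxis₂ ψ) p m‖ ≤ G₂) :
    ∑ Y ∈ V, idxWt (Y - (γ, m)) * ‖sdiff2 ψ (γ, m) Y‖ ≤ 216 * G₂ := by
  have key : ∀ Y ∈ V, idxWt (Y - (γ, m)) * ‖sdiff2 ψ (γ, m) Y‖ ≤ 4 * G₂ * (idxWt (Y - (γ, m)) * (idxNorm (Y - (γ, m)) : ℝ) ^ 2) := by
    intro Y hY
    have hr := hV Y hY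
    obtain ⟨⟨d, t⟩, rfl⟩ : ∃ v : Cell 2 × ℤ, Y = (γ + v.1, m + v.2) := ⟨Y - (γ, m), Prod.ext (by simp) (by simp)⟩
    dsimp only at hr ⊢
    have hv : (γ + d, m + t) - (γ, m) = (d, t) := Prod.ext (add_sub_cancel_left _ _) (add_sub_cancel_left _ _)
    rw [hv] at hr ⊢
    have h := norm_sdiff2_le_of_idxNorm_le ψ γ d m t hr hG0 hG
    have hw := idxWt_nonneg (d, t)
    nlinarith [mul_le_mul_of_nonneg_left h hw]
  refine (sum_le_sum key).trans ?_
  rw [← mul_sum]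
  have h54 := sum_idxWt_mul_sq_le V (γ, m)
  have h4 : (0 : ℝ) ≤ 4 * G₂ := by positivity
  nlinarith [mul_le_mul_of_nonneg_left h54 h4]

/-! ### WE.4  Translation counting -/

/-- index norm of a vector from its coordinates. [formal bookkeeping] -/
theorem idxNorm_mk_le {p : Cell 2} {q : ℤ} {r : ℕ} (h0 : (p 0).natAbs ≤ r) (h1 : (p 1).natAbs ≤ r) (h2 : q.natAbs ≤ r) : idxNorm (p, q) ≤ r := by
  unfold idxNorm
  exact max_le (max_le h0 h1) h2

/-- the path bonds of the first segment stay in the `N(v)`-box. [formal bookkeeping] -/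
theorem idxNorm_path₁_le (d : Cell 2) (t : ℤ) {r : ℕ} (hv : idxNorm (d, t) ≤ r) {i j : ℕ} (hi : i ∈ range (d 0).natAbs) (hj : j ∈ range t.natAbs) :
    idxNorm ((min (d 0) 0 + ((i : ℕ) : ℤ)) • (Pi.single 0 1 : Cell 2), min t 0 + ((j : ℕ) : ℤ)) ≤ r := by
  rw [mem_range] at hi hj
  have h0 : (d 0).natAbs ≤ r := (natAbs_fst_le_idxNorm (d, t) 0).trans hv
  have ht : t.natAbs ≤ r := (natAbs_snd_le_idxNorm (d, t)).trans hv
  refine idxNorm_mk_le ?_ ?_ ?_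
  · simp only [Pi.smul_apply, smul_eq_mul, axisStep₀_apply_zero, mul_one]
    omega
  · simp only [Pi.smul_apply, smul_eq_mul, axisStep₀_apply_one, mul_zero, Int.natAbs_zero]
    exact Nat.zero_le _
  · omega

/-- the path bonds of the second segment stay in the `N(v)`-box. [formal bookkeeping] -/
theorem idxNorm_path₂_le (d : Cell 2) (t : ℤ) {r : ℕ} (hv : idxNorm (d, t) ≤ r) {i j : ℕ} (hi : i ∈ range (d 1).natAbs) (hj : j ∈ range t.natAbs) :
    idxNorm (d 0 • (Pi.single 0 1 : Cell 2) + (min (d 1) 0 + ((i : ℕ) : ℤ)) • (Pi.single 1 1 : Cell 2), min t 0 + ((j : ℕ) : ℤ)) ≤ r := by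
  rw [mem_range] at hi hj
  have h0 : (d 0).natAbs ≤ r := (natAbs_fst_le_idxNorm (d, t) 0).trans hv
  have h1 : (d 1).natAbs ≤ r := (natAbs_fst_le_idxNorm (d, t) 1).trans hv
  have ht : t.natAbs ≤ r := (natAbs_snd_le_idxNorm (d, t)).trans hv
  refine idxNorm_mk_le ?_ ?_ ?_
  · simp only [Pi.add_apply, Pi.smul_apply, smul_eq_mul, axisStep₀_apply_zero, axisStep₁_apply_zero, mul_one, mul_zero, add_zero]
    exact h0
  · simp only [Pi.add_apply, Pi.smul_apply, smul_eq_mul, axisStep₀_apply_one, axisStep₁_apply_one, mul_one, mul_zero, zero_add]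
    omega
  · omega

/-- TRANSLATION COUNTING: the sum of a non-negative function over the translate `Xs + u` of a block is at most its sum over any region containing the
translate. [formal bookkeeping] -/
theorem sum_translate_le {Xs R : Finset (Cell 2 × ℤ)} (u : Cell 2 × ℤ) (hR : ∀ X ∈ Xs, X + u ∈ R) (f : Cell 2 × ℤ → ℝ) (hf : ∀ X, 0 ≤ f X) :
    ∑ X ∈ Xs, f (X + u) ≤ ∑ X' ∈ R, f X' :=
  sum_le_sum_of_injOn' (· + u) (fun _ _ _ _ h => add_right_cancel h) hR (fun X' _ => hf X') fun _ _ => le_rfl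

/-- ★ THE BLOCK SUM OF THE PATH SQUARE-SUMS: if `R` contains the `r`-neighbourhood of the block `Xs` and `N(v) ≤ r`, then
`Σ_{X ∈ Xs} pathSq ψ X v ≤ N(v)²·(Σ_{X' ∈ R} ‖D₃D₁ψ X'‖² + Σ_{X' ∈ R} ‖D₃D₂ψ X'‖²)` (each of the `≤ 2N(v)²` path bonds is a translate of `X`).
[this file, g58] -/
theorem sum_pathSq_le (ψ : Cell 2 → ℤ → E3) {Xs R : Finset (Cell 2 × ℤ)} {r : ℕ} (hR : ∀ X ∈ Xs, ∀ u : Cell 2 × ℤ, idxNorm u ≤ r → X + u ∈ R)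
    (v : Cell 2 × ℤ) (hv : idxNorm v ≤ r) :
    ∑ X ∈ Xs, pathSq ψ X v ≤ (idxNorm v : ℝ) ^ 2 *
      ((∑ X' ∈ R, ‖latDiff idxAxis₃ (latDiff idxAxis₁ ψ) X'.1 X'.2‖ ^ 2) + ∑ X' ∈ R, ‖latDiff idxAxis₃ (latDiff idxAxis₂ ψ) X'.1 X'.2‖ ^ 2) := by
  obtain ⟨d, t⟩ := v
  set P₁ := ∑ X' ∈ R, ‖latDiff idxAxis₃ (latDiff idxAxis₁ ψ) X'.1 X'.2‖ ^ 2 with hP₁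
  set P₂ := ∑ X' ∈ R, ‖latDiff idxAxis₃ (latDiff idxAxis₂ ψ) X'.1 X'.2‖ ^ 2 with hP₂
  have hP₁0 : 0 ≤ P₁ := sum_nonneg fun _ _ => sq_nonneg _
  have hP₂0 : 0 ≤ P₂ := sum_nonneg fun _ _ => sq_nonneg _
  have hN0 : (((d 0).natAbs : ℕ) : ℝ) ≤ idxNorm (d, t) := by exact_mod_cast natAbs_fst_le_idxNorm (d, t) 0
  have hN1 : (((d 1).natAbs : ℕ) : ℝ) ≤ idxNorm (d, t) := by exact_mod_cast natAbs_fst_le_idxNorm (d, t) 1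
  have hNt : ((t.natAbs : ℕ) : ℝ) ≤ idxNorm (d, t) := by exact_mod_cast natAbs_snd_le_idxNorm (d, t)
  have h1 : ∀ j ∈ range t.natAbs, ∀ i ∈ range (d 0).natAbs,
      ∑ X ∈ Xs, ‖latDiff idxAxis₃ (latDiff idxAxis₁ ψ) (X.1 + (min (d 0) 0 + ((i : ℕ) : ℤ)) • (Pi.single 0 1 : Cell 2))
        (X.2 + (min t 0 + ((j : ℕ) : ℤ)))‖ ^ 2 ≤ P₁ := fun j hj i hi =>
    sum_translate_le ((min (d 0) 0 + ((i : ℕ) : ℤ)) • (Pi.single 0 1 : Cell 2), min t 0 + ((j : ℕ) : ℤ))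
      (fun X hX => hR X hX _ (idxNorm_path₁_le d t hv hi hj)) (fun X' => ‖latDiff idxAxis₃ (latDiff idxAxis₁ ψ) X'.1 X'.2‖ ^ 2) fun _ => sq_nonneg _
  have h2 : ∀ j ∈ range t.natAbs, ∀ i ∈ range (d 1).natAbs,
      ∑ X ∈ Xs, ‖latDiff idxAxis₃ (latDiff idxAxis₂ ψ) (X.1 + (d 0 • (Pi.single 0 1 : Cell 2) + (min (d 1) 0 + ((i : ℕ) : ℤ)) • (Pi.single 1 1 : Cell 2)))
        (X.2 + (min t 0 + ((j : ℕ) : ℤ)))‖ ^ 2 ≤ P₂ := fun j hj i hi =>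
    sum_translate_le (d 0 • (Pi.single 0 1 : Cell 2) + (min (d 1) 0 + ((i : ℕ) : ℤ)) • (Pi.single 1 1 : Cell 2), min t 0 + ((j : ℕ) : ℤ))
      (fun X hX => hR X hX _ (idxNorm_path₂_le d t hv hi hj)) (fun X' => ‖latDiff idxAxis₃ (latDiff idxAxis₂ ψ) X'.1 X'.2‖ ^ 2) fun _ => sq_nonneg _
  calc ∑ X ∈ Xs, pathSq ψ X (d, t)
      = ∑ j ∈ range t.natAbs, ∑ X ∈ Xs,
          ((∑ i ∈ range (d 0).natAbs, ‖latDiff idxAxis₃ (latDiff idxAxis₁ ψ) (X.1 + (min (d 0) 0 + ((i : ℕ) : ℤ)) • (Pi.single 0 1 : Cell 2))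
              (X.2 + (min t 0 + ((j : ℕ) : ℤ)))‖ ^ 2) +
            ∑ i ∈ range (d 1).natAbs,
              ‖latDiff idxAxis₃ (latDiff idxAxis₂ ψ) (X.1 + (d 0 • (Pi.single 0 1 : Cell 2) + (min (d 1) 0 + ((i : ℕ) : ℤ)) • (Pi.single 1 1 : Cell 2)))
                (X.2 + (min t 0 + ((j : ℕ) : ℤ)))‖ ^ 2) := by
        rw [sum_comm]
        rfl
    _ ≤ ∑ j ∈ range t.natAbs, ((∑ i ∈ range (d 0).natAbs, P₁) + ∑ i ∈ range (d 1).natAbs, P₂) := by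
        refine sum_le_sum fun j hj => ?_
        have hA : ∑ X ∈ Xs, ∑ i ∈ range (d 0).natAbs,
            ‖latDiff idxAxis₃ (latDiff idxAxis₁ ψ) (X.1 + (min (d 0) 0 + ((i : ℕ) : ℤ)) • (Pi.single 0 1 : Cell 2)) (X.2 + (min t 0 + ((j : ℕ) : ℤ)))‖ ^ 2 ≤
            ∑ i ∈ range (d 0).natAbs, P₁ := by
          rw [sum_comm]
          exact sum_le_sum fun i hi => h1 j hj i hi
        have hB : ∑ X ∈ Xs, ∑ i ∈ range (d 1).natAbs,
            ‖latDiff idxAxis₃ (latDiff idxAxis₂ ψ) (X.1 + (d 0 • (Pi.single 0 1 : Cell 2) + (min (d 1) 0 + ((i : ℕ) : ℤ)) • (Pi.single 1 1 : Cell 2)))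
              (X.2 + (min t 0 + ((j : ℕ) : ℤ)))‖ ^ 2 ≤ ∑ i ∈ range (d 1).natAbs, P₂ := by
          rw [sum_comm]
          exact sum_le_sum fun i hi => h2 j hj i hi
        rw [sum_add_distrib]
        exact add_le_add hA hB
    _ = ((t.natAbs : ℕ) : ℝ) * ((((d 0).natAbs : ℕ) : ℝ) * P₁ + (((d 1).natAbs : ℕ) : ℝ) * P₂) := by
        simp only [sum_const, card_range, nsmul_eq_mul]
    _ ≤ (idxNorm (d, t) : ℝ) * ((idxNorm (d, t) : ℝ) * P₁ + (idxNorm (d, t) : ℝ) * P₂) :=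
        mul_le_mul hNt (add_le_add (mul_le_mul_of_nonneg_right hN0 hP₁0) (mul_le_mul_of_nonneg_right hN1 hP₂0)) (by positivity)
          (Nat.cast_nonneg _)
    _ = (idxNorm (d, t) : ℝ) ^ 2 * (P₁ + P₂) := by ring

/-- NEAR SITES AS OFFSETS: a non-negative function of the offset summed over the near sites of `X` is at most its sum over the index box of radius
`⌊ϱ/c⌋` (VJ `idxNorm_le_of_near`). [formal bookkeeping] -/
theorem sum_near_le_sum_idxBox (hc : 0 < c) (hL : IsLayeredCrystal c a b w) (ϱ : ℝ) (X : Cell 2 × ℤ) (g : Cell 2 × ℤ → ℝ) (hg : ∀ v, 0 ≤ g v) :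
    ∑ Y ∈ (finite_near_lsite hc hL X ϱ).toFinset, g (Y - X) ≤ ∑ v ∈ idxBox ⌊ϱ / c⌋₊, g v :=
  sum_le_sum_of_injOn' (· - X) (fun _ _ _ _ h => sub_left_injective h)
    (fun _ hY => mem_idxBox (idxNorm_le_of_near hc hL ((finite_near_lsite hc hL X ϱ).mem_toFinset.mp hY))) (fun v _ => hg v) fun _ _ => le_rfl

/-! ### WE.5  ★ The square sum of the divergence over a block -/

/-- ★★★ THE SQUARE SUM OF THE COLUMN-FLUX DIVERGENCE OVER A BLOCK `Xs` of sites at which `ψ` is harmonic (layers in `T`, which also contains the layers of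
all near sites): with `P₁ + P₂` the square sums of the mixed second differences `D₃D₁ψ`, `D₃D₂ψ` over a region `R` containing the `⌊ϱ/c⌋`-neighbourhood of
the block and `G₂` a bound of the in-plane second differences on its `3⌊ϱ/c⌋`-neighbourhood,
`Σ_{X ∈ Xs} ‖colFlux T ψ X.1 X.2 − colFlux T ψ X.1 (X.2 − 1)‖² ≤ 8F²·(5832·(P₁ + P₂) + #Xs·(216·G₂)²)`. [this file, g58] -/
theorem sum_colFluxDiv_sq_le (hc : 0 < c) (hL : IsLayeredCrystal c a b w) {ϱ : ℝ} (ψ : Cell 2 → ℤ → E3) {T : Finset ℤ} {Xs R : Finset (Cell 2 × ℤ)}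
    (hT : ∀ X ∈ Xs, X.2 ∈ T) (hS : ∀ X ∈ Xs, ∀ Y : Cell 2 × ℤ, ‖lsite a b w Y.1 Y.2 - lsite a b w X.1 X.2‖ ≤ ϱ → Y.2 ∈ T)
    (hres : ∀ X ∈ Xs, truncResidual ϱ a b w ψ X = 0) (hR : ∀ X ∈ Xs, ∀ u : Cell 2 × ℤ, idxNorm u ≤ ⌊ϱ / c⌋₊ → X + u ∈ R) {G₂ : ℝ} (hG0 : 0 ≤ G₂)
    (hG : ∀ X ∈ Xs, ∀ p : Cell 2, (∀ j, |p j - X.1 j| ≤ 3 * (⌊ϱ / c⌋₊ : ℤ)) →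
      ‖latDiff idxAxis₁ (latDiff idxAxis₁ ψ) p X.2‖ ≤ G₂ ∧ ‖latDiff idxAxis₂ (latDiff idxAxis₁ ψ) p X.2‖ ≤ G₂ ∧
      ‖latDiff idxAxis₁ (latDiff idxAxis₂ ψ) p X.2‖ ≤ G₂ ∧ ‖latDiff idxAxis₂ (latDiff idxAxis₂ ψ) p X.2‖ ≤ G₂) :
    ∑ X ∈ Xs, ‖colFlux ϱ a b w T ψ X.1 X.2 - colFlux ϱ a b w T ψ X.1 (X.2 - 1)‖ ^ 2 ≤
      8 * kernelConst c ^ 2 * (5832 * ((∑ X' ∈ R, ‖latDiff idxAxis₃ (latDiff idxAxis₁ ψ) X'.1 X'.2‖ ^ 2) +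
        ∑ X' ∈ R, ‖latDiff idxAxis₃ (latDiff idxAxis₂ ψ) X'.1 X'.2‖ ^ 2) + #Xs * (216 * G₂) ^ 2) := by
  set P := (∑ X' ∈ R, ‖latDiff idxAxis₃ (latDiff idxAxis₁ ψ) X'.1 X'.2‖ ^ 2) + ∑ X' ∈ R, ‖latDiff idxAxis₃ (latDiff idxAxis₂ ψ) X'.1 X'.2‖ ^ 2
    with hP
  have hP0 : 0 ≤ P := add_nonneg (sum_nonneg fun _ _ => sq_nonneg _) (sum_nonneg fun _ _ => sq_nonneg _)
  have hF := kernelConst_nonneg hc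
  -- the pointwise bound at a site of the block
  have hpt : ∀ X ∈ Xs, ‖colFlux ϱ a b w T ψ X.1 X.2 - colFlux ϱ a b w T ψ X.1 (X.2 - 1)‖ ^ 2 ≤
      8 * kernelConst c ^ 2 * (108 * ∑ v ∈ idxBox ⌊ϱ / c⌋₊, idxWt v * pathSq ψ X v + (216 * G₂) ^ 2) := by
    rintro ⟨γ, m⟩ hX
    dsimp only
    have hdiv := norm_colFluxDiv_le hc hL ψ (hT _ hX) (hS _ hX) (hres _ hX)
    have hAP : (∑ Y ∈ (finite_near_lsite hc hL (γ, m) ϱ).toFinset, idxWt (Y - (γ, m)) * ‖pgram ψ (γ, m) Y‖) ^ 2 ≤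
        108 * ∑ v ∈ idxBox ⌊ϱ / c⌋₊, idxWt v * pathSq ψ (γ, m) v := by
      refine (sum_wt_pgram_sq_le ψ γ m _).trans (mul_le_mul_of_nonneg_left ?_ (by norm_num))
      exact sum_near_le_sum_idxBox hc hL ϱ (γ, m) (fun v => idxWt v * pathSq ψ (γ, m) v) fun v => mul_nonneg (idxWt_nonneg v) (pathSq_nonneg _ _ _)
    have hAS : ∑ Y ∈ (finite_near_lsite hc hL (γ, m) ϱ).toFinset, idxWt (Y - (γ, m)) * ‖sdiff2 ψ (γ, m) Y‖ ≤ 216 * G₂ :=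
      sum_wt_sdiff2_le ψ γ m _ (fun Y hY => idxNorm_le_of_near hc hL ((finite_near_lsite hc hL (γ, m) ϱ).mem_toFinset.mp hY)) hG0 (hG _ hX)
    have hdiv' : ‖colFlux ϱ a b w T ψ γ m - colFlux ϱ a b w T ψ γ (m - 1)‖ ≤ 2 * kernelConst c *
        ((∑ Y ∈ (finite_near_lsite hc hL (γ, m) ϱ).toFinset, idxWt (Y - (γ, m)) * ‖pgram ψ (γ, m) Y‖) +
          ∑ Y ∈ (finite_near_lsite hc hL (γ, m) ϱ).toFinset, idxWt (Y - (γ, m)) * ‖sdiff2 ψ (γ, m) Y‖) := by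
      refine hdiv.trans (le_of_eq ?_)
      rw [← sum_add_distrib]
      exact congrArg _ (sum_congr rfl fun Y _ => by ring)
    set A := ∑ Y ∈ (finite_near_lsite hc hL (γ, m) ϱ).toFinset, idxWt (Y - (γ, m)) * ‖pgram ψ (γ, m) Y‖ with hA
    set S := ∑ Y ∈ (finite_near_lsite hc hL (γ, m) ϱ).toFinset, idxWt (Y - (γ, m)) * ‖sdiff2 ψ (γ, m) Y‖ with hS'
    have hS0 : 0 ≤ S := sum_nonneg fun Y _ => mul_nonneg (idxWt_nonneg _) (norm_nonneg _)
    have hsq := pow_le_pow_left₀ (norm_nonneg _) hdiv' 2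
    have hS2 : S ^ 2 ≤ (216 * G₂) ^ 2 := pow_le_pow_left₀ hS0 hAS 2
    have h1 : (A + S) ^ 2 ≤ 2 * (A ^ 2 + S ^ 2) := by nlinarith [sq_nonneg (A - S)]
    have key : (2 * kernelConst c * (A + S)) ^ 2 ≤ 8 * kernelConst c ^ 2 * (108 * ∑ v ∈ idxBox ⌊ϱ / c⌋₊, idxWt v * pathSq ψ (γ, m) v + (216 * G₂) ^ 2) :=
      calc (2 * kernelConst c * (A + S)) ^ 2 = 4 * kernelConst c ^ 2 * (A + S) ^ 2 := by ring
        _ ≤ 4 * kernelConst c ^ 2 * (2 * (108 * ∑ v ∈ idxBox ⌊ϱ / c⌋₊, idxWt v * pathSq ψ (γ, m) v + (216 * G₂) ^ 2)) :=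
            mul_le_mul_of_nonneg_left (h1.trans (by linarith)) (by positivity)
        _ = _ := by ring
    exact hsq.trans key
  -- summing the path square-sums over the block, offset by offset
  have hsumP : ∑ X ∈ Xs, ∑ v ∈ idxBox ⌊ϱ / c⌋₊, idxWt v * pathSq ψ X v ≤ 54 * P := by
    rw [sum_comm]
    have h54 : ∑ v ∈ idxBox ⌊ϱ / c⌋₊, idxWt v * (idxNorm v : ℝ) ^ 2 ≤ 54 := by
      simpa only [sub_zero] using sum_idxWt_mul_sq_le (idxBox ⌊ϱ / c⌋₊) 0
    calc ∑ v ∈ idxBox ⌊ϱ / c⌋₊, ∑ X ∈ Xs, idxWt v * pathSq ψ X v ≤ ∑ v ∈ idxBox ⌊ϱ / c⌋₊, idxWt v * (idxNorm v : ℝ) ^ 2 * P :=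
          sum_le_sum fun v hv => by
            rw [← mul_sum, mul_assoc]
            exact mul_le_mul_of_nonneg_left (sum_pathSq_le ψ hR v (idxNorm_le_of_mem_idxBox hv)) (idxWt_nonneg v)
      _ = (∑ v ∈ idxBox ⌊ϱ / c⌋₊, idxWt v * (idxNorm v : ℝ) ^ 2) * P := by rw [sum_mul]
      _ ≤ 54 * P := mul_le_mul_of_nonneg_right h54 hP0
  calc ∑ X ∈ Xs, ‖colFlux ϱ a b w T ψ X.1 X.2 - colFlux ϱ a b w T ψ X.1 (X.2 - 1)‖ ^ 2
      ≤ ∑ X ∈ Xs, 8 * kernelConst c ^ 2 * (108 * ∑ v ∈ idxBox ⌊ϱ / c⌋₊, idxWt v * pathSq ψ X v + (216 * G₂) ^ 2) := sum_le_sum hpt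
    _ = 8 * kernelConst c ^ 2 * (108 * ∑ X ∈ Xs, ∑ v ∈ idxBox ⌊ϱ / c⌋₊, idxWt v * pathSq ψ X v + #Xs * (216 * G₂) ^ 2) := by
        rw [← mul_sum, sum_add_distrib, ← mul_sum, sum_const, nsmul_eq_mul]
    _ ≤ 8 * kernelConst c ^ 2 * (5832 * P + #Xs * (216 * G₂) ^ 2) :=
        mul_le_mul_of_nonneg_left (by linarith [hsumP]) (by positivity)

/-! ### WE.6  The closed statement of this part -/

/-- The content of part WE as one closed proposition: the parallelogram bound in mean square and the square sum of the column-flux divergence over a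
block of sites. -/
def DivergenceL2Shape : Prop :=
  (∀ (ψ : Cell 2 → ℤ → E3) (γ d : Cell 2) (m t : ℤ), ‖pgram ψ (γ, m) (γ + d, m + t)‖ ^ 2 ≤ 2 * (idxNorm (d, t) : ℝ) ^ 2 * pathSq ψ (γ, m) (d, t)) ∧
  ∀ c : ℝ, 0 < c → ∀ (a b : E3) (w : ℤ → E3), IsLayeredCrystal c a b w → ∀ (ϱ : ℝ) (ψ : Cell 2 → ℤ → E3) (T : Finset ℤ) (Xs R : Finset (Cell 2 × ℤ)),
    (∀ X ∈ Xs, X.2 ∈ T) → (∀ X ∈ Xs, ∀ Y : Cell 2 × ℤ, ‖lsite a b w Y.1 Y.2 - lsite a b w X.1 X.2‖ ≤ ϱ → Y.2 ∈ T) →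
    (∀ X ∈ Xs, truncResidual ϱ a b w ψ X = 0) → (∀ X ∈ Xs, ∀ u : Cell 2 × ℤ, idxNorm u ≤ ⌊ϱ / c⌋₊ → X + u ∈ R) → ∀ G₂ : ℝ, 0 ≤ G₂ →
    (∀ X ∈ Xs, ∀ p : Cell 2, (∀ j, |p j - X.1 j| ≤ 3 * (⌊ϱ / c⌋₊ : ℤ)) →
      ‖latDiff idxAxis₁ (latDiff idxAxis₁ ψ) p X.2‖ ≤ G₂ ∧ ‖latDiff idxAxis₂ (latDiff idxAxis₁ ψ) p X.2‖ ≤ G₂ ∧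
      ‖latDiff idxAxis₁ (latDiff idxAxis₂ ψ) p X.2‖ ≤ G₂ ∧ ‖latDiff idxAxis₂ (latDiff idxAxis₂ ψ) p X.2‖ ≤ G₂) →
    ∑ X ∈ Xs, ‖colFlux ϱ a b w T ψ X.1 X.2 - colFlux ϱ a b w T ψ X.1 (X.2 - 1)‖ ^ 2 ≤
      8 * kernelConst c ^ 2 * (5832 * ((∑ X' ∈ R, ‖latDiff idxAxis₃ (latDiff idxAxis₁ ψ) X'.1 X'.2‖ ^ 2) +
        ∑ X' ∈ R, ‖latDiff idxAxis₃ (latDiff idxAxis₂ ψ) X'.1 X'.2‖ ^ 2) + #Xs * (216 * G₂) ^ 2)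

/-- WE holds. [this file, g58] -/
theorem divergenceL2Shape_holds : DivergenceL2Shape :=
  ⟨norm_pgram_sq_le, fun _c hc _a _b _w hL _ϱ ψ _T _Xs _R hT hS hres hR _G₂ hG0 hG => sum_colFluxDiv_sq_le hc hL ψ hT hS hres hR hG0 hG⟩

end DivergenceL2

end Summit.AtomisticToContinuum.Crystallization.Theorems.ChartedZeroExcessLayeredLatticeLiouville
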